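import Literature.Claims.NS.Guevremont2026
import Summits.NavierStokesRegularity.NavierStokesRegularity.Theorems.SoloRefuteLucardoOlivaes2026
import Summits.NavierStokesRegularity.NavierStokesRegularity.Theorems.SoloSalvageLucardoOlivaes2026Enstrophy
import HarnessLib

/-!
# C143 `Guevremont2026` — refutation of Step 3 (`Step3_EnstrophyLaw`, the global enstrophy law §4.1 p.5 l.52–66)

Cell `ns-claims` (D-0090), claim C143, refuter of record `ns-claims-refuter-3` (g4). Skeleton
`Literature/Claims/NS/Guevremont2026.lean` (ns-claims-typist-4 g5, p524290).

**Located step.** `Step3_EnstrophyLaw R` types «Integrating over space gives the global enstrophy inequality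
dΩ/dt ≤ CΩ^{3/2} − (1/δ)Ω², where Ω(t) = ½∫_{R³}|ω|² dx and δ > 0 is any fixed positive resolution
parameter» (p.5 l.52–66) along EVERY smooth solution of (1)–(2) on `ℝ³ × [0,T)` from a datum of the printed
class, with ONE choice `R` of the printed constants `C`, `δ > 0` for all solutions (as printed: «time-
independent», p.5 l.74). It is the first load-bearing binder of `claim_of_steps` after `Step0_BKM`.

**Why it is false (for every `R`).** AMPLITUDE RAY at the initial time. Take the tree's compactly supported
smooth divergence-free swirling bump `u0` (C137 kit) and the data `A • u0`, `A > 0`; each is in the printed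
class for every Sobolev index (`isDatum_of_hasCompactSupport`) and launches a regular local solution of the
Beale–Kato–Majda class with `ν = 1` (`exists_isLocalSolution`). Along it `Ω(s) = ½∫|ω(s)|²` is `C¹` up to
`s = 0` with right-derivative `Ω'(0⁺) = A³·S₀ − A²·P₀`, `S₀ = ∫⟪ω₀,(∇u0)ω₀⟫`, `P₀ = ∫|∇ω₀|²_F ≥ 0`
(enstrophy identity of the tree, Majda–Bertozzi (3.4)), while `Ω(0) = A²e`, `e = ½∫|curl u0|² > 0`. The
typed law on `(0,T)` passes to `s = 0⁺` (mean value theorem: `rightDeriv_le_of_deriv_le`), giving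
`A³S₀ − A²P₀ ≤ C(A²e)^{3/2} − (A²e)²/δ`. The right side is `≤ −A⁴e²/(2δ)` once `A²e ≥ (2δ(|C|+1))²`, the left
side is `≥ −A³(|S₀| + P₀)`: false for `A` large (`endgame`; degree 4 against degree 3). In words: real
Navier–Stokes solutions do not dissipate enstrophy at the quartic rate `Ω²/δ` the lattice «pivot
redistribution» is said to supply — at large amplitude the true initial enstrophy budget is cubic.

Classification (D-0016 vocabulary): refuted-SUBSTANTIVE at the NS grain — no side condition on the data
repairs a solution-independent absorbing term `−Ω²/δ` (any normalisation of `u0` is undone by the ray; NS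
scaling (3) p.1 kills every class-uniform `(C, δ)` as well, ref-3 g6 RETYPE K1); the only «repair» is the
lattice reading (the law as a statement about D3Q13 fields with cut-off `k_max = 1/(cδ)`), under which the
chain no longer speaks about (1)–(2) (Δ2, wrong problem) — recorded in REFUTER.md, not keyed here.

Main theorem: `not_Step3_EnstrophyLaw (R) : ¬ Literature.Claims.NS.Guevremont2026.Step3_EnstrophyLaw R`.

WHAT THIS IS NOT: not a claim about NS regularity or blow-up; not a claim about any author beyond the typed
locator.
-/

set_option linter.dupNamespace false

noncomputable section

open Set Filter MeasureTheory
open _root_.Topology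
open scoped ENNReal NNReal ContDiff RealInnerProductSpace

namespace Summit.NavierStokesRegularity.NavierStokesRegularity.Theorems.Guevremont2026

open Literature.Analysis.FluidPDE
open Literature.Claims.NS.Chae2007 (IsDatum IsLocalSolution)
open Literature.Claims.NS.LucardoOlivaes2026 (ensq stretchI)
open Literature.Claims.NS.Lindgren2012 (enstrophy stretchPerp stretch dissip stretchPerp_eq)
open Summit.NavierStokesRegularity.NavierStokesRegularity.Theorems.Lindgren2012Salvage
  (lindgren2012_step3_holds integral_stretching_eq_stretch dissip_eq_neg_integral_frobeniusNormSq)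
open Summit.NavierStokesRegularity.NavierStokesRegularity.Theorems.LucardoOlivaes2026

/-- Physical space `ℝ³`. [folklore] -/
abbrev E3 : Type := EuclideanSpace ℝ (Fin 3)

/-- Frobenius palinstrophy `∫ |∇ω|²_F` of a field. [folklore] -/
def palinF (v : E3 → E3) : ℝ := ∫ x, frobeniusNormSq (fderiv ℝ (curl v) x)

/-- **One-sided enstrophy evolution at the initial time**: along every regular solution of the BKM class
with `ν > 0` on `[0,T)`, `T > 0`, the function `s ↦ ½∫|ω(s)|²` has, at `s = 0` within `[0,T/2]`, the
derivative `∫⟪ω₀,(∇v₀)ω₀⟫ − ν∫|∇ω₀|²_F` of the datum. [cite: MajdaBertozziCUP2002, §3.1.1 p. 87–88] -/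
theorem hasDerivWithinAt_half_ensq_zero {ν T : ℝ} (hν : 0 < ν) (hT : 0 < T) {v₀ : E3 → E3}
    {u : ℝ → E3 → E3} {p : ℝ → E3 → ℝ} (h : IsLocalSolution ν T v₀ u p) :
    HasDerivWithinAt (fun s => (1 / 2 : ℝ) * ensq u s) (stretchI v₀ - ν * palinF v₀) (Icc 0 (T / 2)) 0 := by
  rw [← h.initial]
  have hT''T : T / 2 < T := by linarith
  have hT''0 : 0 < T / 2 := by linarith
  have hsol := isSolutionOn_of_isLocalSolution h hT''0 hT''T
  have htI : (0 : ℝ) ∈ Icc 0 (T / 2) := ⟨le_rfl, hT''0.le⟩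
  have hW := lindgren2012_step3_holds ν (T / 2) u p hν hT''0 hsol 0 htI
  have hS : IsClassicalNSSolutionOn (Icc 0 (T / 2)) ν 0 u p := hsol.isClassical
  have hB : HasBoundedSobolevNormsOn (Icc 0 (T / 2)) u := hsol.sobolev
  have hsm : ContDiff ℝ ∞ (u 0) := hS.contDiff_velocity htI
  obtain ⟨B₀, hB₀⟩ := linfty_bound_of_hasBoundedSobolevNormsOn_holds
    (fun s hs => (hS.contDiff_velocity hs).of_le (by norm_cast)) hB
  obtain ⟨B₁, -, hB₁⟩ := exists_forall_norm_fderiv_le_of_hasBoundedSobolevNormsOn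
    (fun s hs => (hS.contDiff_velocity hs).of_le (by norm_cast)) hB
  have hfin : ∀ n : ℕ, ∫⁻ x, ‖iteratedFDeriv ℝ n (u 0) x‖ₑ ^ 2 < ⊤ := fun n => by
    obtain ⟨C, hC⟩ := hB n
    exact (hC 0 htI).trans_lt ENNReal.coe_lt_top
  have h1 : stretchPerp (u 0) = stretchI (u 0) := by
    rw [stretchPerp_eq, ← integral_stretching_eq_stretch hsm (hS.divFree 0 htI) (hB₀ 0 htI) (hB₁ 0 htI)
      (hfin 1) (hfin 2)]
    rfl
  have h2 : dissip (u 0) = -∫ x, frobeniusNormSq (fderiv ℝ (curl (u 0)) x) :=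
    dissip_eq_neg_integral_frobeniusNormSq hsm (hfin 1) (hfin 2) (hfin 3)
  have hD' := hW.const_mul (1 / 2 : ℝ)
  have hfun : (fun s => (1 / 2 : ℝ) * ensq u s) = fun s => (1 / 2 : ℝ) * enstrophy (u s) := rfl
  rw [hfun]
  refine hD'.congr_deriv ?_
  rw [h1, h2, palinF]
  ring

/-- **Slope lemma**: if `Ω` is continuous on `[0,τ]`, has right-derivative `D` at `0`, is differentiable on
`(0,τ)` with `Ω' ≤ g(Ω)` there, and `g` is continuous at `Ω(0)`, then `D ≤ g(Ω(0))` (mean value theorem).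
[folklore] -/
theorem rightDeriv_le_of_deriv_le {Ω g : ℝ → ℝ} {D τ : ℝ} (hτ : 0 < τ)
    (hder : HasDerivWithinAt Ω D (Icc 0 τ) 0) (hc : ContinuousOn Ω (Icc 0 τ))
    (hd : ∀ t ∈ Ioo 0 τ, DifferentiableAt ℝ Ω t) (hle : ∀ t ∈ Ioo 0 τ, deriv Ω t ≤ g (Ω t))
    (hg : ContinuousAt g (Ω 0)) : D ≤ g (Ω 0) := by
  by_contra hlt
  have hlt : g (Ω 0) < D := not_le.mp hlt
  set ε : ℝ := (D - g (Ω 0)) / 2 with hε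
  have hεpos : 0 < ε := by rw [hε]; linarith
  -- slopes near `0⁺` are close to `D`
  have hslope : Tendsto (slope Ω 0) (𝓝[Icc 0 τ \ {0}] 0) (𝓝 D) :=
    hasDerivWithinAt_iff_tendsto_slope.mp hder
  obtain ⟨ρ, hρ, hρP⟩ := Metric.tendsto_nhdsWithin_nhds.mp hslope ε hεpos
  -- `g ∘ Ω` near `0⁺` is close to `g (Ω 0)`
  have hcont : Tendsto (fun t => g (Ω t)) (𝓝[Icc 0 τ] 0) (𝓝 (g (Ω 0))) :=
    hg.tendsto.comp (hc 0 ⟨le_rfl, hτ.le⟩).tendsto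
  obtain ⟨η, hη, hηP⟩ := Metric.tendsto_nhdsWithin_nhds.mp hcont ε hεpos
  -- a point `t` in `(0, τ]` within both radii
  set t : ℝ := min (min ρ η) τ / 2 with ht
  have hmin : 0 < min (min ρ η) τ := lt_min (lt_min hρ hη) hτ
  have ht0 : 0 < t := by rw [ht]; linarith
  have htρ : t < ρ := by
    have : min (min ρ η) τ ≤ ρ := (min_le_left _ _).trans (min_le_left _ _)
    rw [ht]; linarith
  have htη : t < η := by
    have : min (min ρ η) τ ≤ η := (min_le_left _ _).trans (min_le_right _ _)
    rw [ht]; linarith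
  have htτ : t < τ := by
    have : min (min ρ η) τ ≤ τ := min_le_right _ _
    rw [ht]; linarith
  -- mean value theorem on `[0, t]`
  obtain ⟨ξ, hξ, hξeq⟩ := exists_deriv_eq_slope Ω ht0 (hc.mono (Icc_subset_Icc_right htτ.le))
    (fun x hx => (hd x ⟨hx.1, hx.2.trans htτ⟩).differentiableWithinAt)
  -- the slope at `t` exceeds `D - ε`
  have hs := hρP (x := t) ⟨⟨ht0.le, htτ.le⟩, ht0.ne'⟩
    (by rw [dist_zero_right, Real.norm_eq_abs, abs_of_pos ht0]; exact htρ)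
  rw [slope_def_field, Real.dist_eq] at hs
  have hs' : D - ε < (Ω t - Ω 0) / (t - 0) := by
    have := (abs_lt.mp hs).1; linarith
  -- `g (Ω ξ)` is below `g (Ω 0) + ε`
  have hx := hηP (x := ξ) ⟨hξ.1.le, (hξ.2.trans htτ).le⟩
    (by rw [dist_zero_right, Real.norm_eq_abs, abs_of_pos hξ.1]; exact hξ.2.trans htη)
  rw [Real.dist_eq] at hx
  have hx' : g (Ω ξ) < g (Ω 0) + ε := by
    have := (abs_lt.mp hx).2; linarith
  have hkey := hle ξ ⟨hξ.1, hξ.2.trans htτ⟩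
  rw [hξeq] at hkey
  have : D - ε = g (Ω 0) + ε := by rw [hε]; ring
  linarith

/-- Frobenius palinstrophy is quadratic in the amplitude. [folklore] -/
theorem palinF_smul (l : ℝ) (v : E3 → E3) : palinF (l • v) = l ^ 2 * palinF v := by
  rw [palinF, palinF, ← integral_const_mul]
  congr 1; funext x
  rw [curl_smul_fun, fderiv_const_smul_real]
  simp only [frobeniusNormSq, _root_.smul_apply, norm_smul, mul_pow, Real.norm_eq_abs, sq_abs,
    Finset.mul_sum]

/-- `0 ≤ ∫|∇ω|²_F`. [folklore] -/
theorem palinF_nonneg (v : E3 → E3) : 0 ≤ palinF v :=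
  integral_nonneg fun x => Finset.sum_nonneg fun i _ => by positivity

/-- The explicit swirling-bump datum of the C137 kit scaled by `A`: `A • u0` is a datum of the BKM class.
[folklore] -/
theorem isDatum_smul_u0 (A : ℝ) : IsDatum (A • u0) := isDatum_smul isOuroDatum_u0.1 A


/-- For `K > 0` and `x ≥ K²`: `x·√x ≤ x²/K`. [folklore] -/
theorem mul_sqrt_le_sq_div {x K : ℝ} (hK : 0 < K) (hx : K ^ 2 ≤ x) : x * Real.sqrt x ≤ x ^ 2 / K := by
  have hx0 : 0 ≤ x := le_trans (sq_nonneg K) hx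
  have hKs : K ≤ Real.sqrt x := by
    rw [← Real.sqrt_sq hK.le]; exact Real.sqrt_le_sqrt hx
  rw [le_div_iff₀ hK]
  have hs0 : 0 ≤ Real.sqrt x := Real.sqrt_nonneg x
  have hss : Real.sqrt x * Real.sqrt x = x := Real.mul_self_sqrt hx0
  nlinarith [mul_le_mul_of_nonneg_left hKs (mul_nonneg hx0 hs0)]

/-- Continuity of `s ↦ ½∫|ω(s)|²` on `[0,T/2]` along a regular solution. [folklore] -/
theorem continuousOn_half_ensq {ν T : ℝ} (hν : 0 < ν) (hT : 0 < T) {v₀ : E3 → E3}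
    {u : ℝ → E3 → E3} {p : ℝ → E3 → ℝ} (h : IsLocalSolution ν T v₀ u p) :
    ContinuousOn (fun s => (1 / 2 : ℝ) * ensq u s) (Icc 0 (T / 2)) := by
  have hT''T : T / 2 < T := by linarith
  have hT''0 : 0 < T / 2 := by linarith
  have hsol := isSolutionOn_of_isLocalSolution h hT''0 hT''T
  intro t ht
  have hW := lindgren2012_step3_holds ν (T / 2) u p hν hT''0 hsol t ht
  exact (hW.continuousWithinAt).const_smul (1 / 2 : ℝ) |>.congr (fun s _ => rfl) rfl

/-- Interior differentiability of `s ↦ ½∫|ω(s)|²` with the classical derivative. [folklore] -/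
theorem differentiableAt_half_ensq {ν T : ℝ} (hν : 0 < ν) {v₀ : E3 → E3}
    {u : ℝ → E3 → E3} {p : ℝ → E3 → ℝ} (h : IsLocalSolution ν T v₀ u p) {t : ℝ} (ht : t ∈ Ioo 0 T) :
    DifferentiableAt ℝ (fun s => (1 / 2 : ℝ) * ensq u s) t :=
  (hasDerivAt_half_ensq hν h ht).differentiableAt

/-- `∫|curl u0|² > 0` for the swirling bump. [folklore] -/
theorem ens_u0_pos : 0 < ∫ x, ‖curl u0 x‖ ^ 2 := ens_pos isOuroDatum_u0

/-- **The amplitude family**: for `ν > 0` and every amplitude `A`, the datum `A • u0` launches a regular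
local solution whose half-enstrophy `Ω(s) = ½∫|ω(s)|²` starts at `Ω(0) = A²·½∫|curl u0|²`, is continuous on
`[0,T/2]`, differentiable inside, and has right-derivative `A³·∫⟪ω,(∇u0)ω⟫ − ν·A²·∫|∇ curl u0|²_F` at `s = 0`.
[cite: MajdaBertozziCUP2002, Thm. 3.4 p. 104; §3.1.1 p. 87–88] -/
theorem amplitude_family {ν : ℝ} (hν : 0 < ν) (A : ℝ) :
    ∃ T : ℝ, 0 < T ∧ ∃ (u : ℝ → E3 → E3) (p : ℝ → E3 → ℝ), IsLocalSolution ν T (A • u0) u p ∧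
      (1 / 2 : ℝ) * ensq u 0 = A ^ 2 * ((1 / 2 : ℝ) * ∫ x, ‖curl u0 x‖ ^ 2) ∧
      ContinuousOn (fun s => (1 / 2 : ℝ) * ensq u s) (Icc 0 (T / 2)) ∧
      (∀ t ∈ Ioo 0 T, DifferentiableAt ℝ (fun s => (1 / 2 : ℝ) * ensq u s) t) ∧
      HasDerivWithinAt (fun s => (1 / 2 : ℝ) * ensq u s)
        (A ^ 3 * stretchI u0 - ν * (A ^ 2 * palinF u0)) (Icc 0 (T / 2)) 0 := by
  obtain ⟨T, hT, u, p, hsol⟩ := exists_isLocalSolution hν.le (isDatum_smul_u0 A)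
  refine ⟨T, hT, u, p, hsol, ?_, continuousOn_half_ensq hν hT hsol,
    fun t ht => differentiableAt_half_ensq hν hsol ht, ?_⟩
  · rw [ensq, hsol.initial, ens_smul]; ring
  · have h := hasDerivWithinAt_half_ensq_zero hν hT hsol
    rwa [stretchI_smul, palinF_smul] at h

/-- **Real-number endgame**: whatever the cubic/quadratic coefficients `S`, `P ≥ 0` of the true initial
enstrophy rate `A³S − νA²P` and whatever the constants `C`, `δ > 0`, a large amplitude `A` violates
`rate ≤ C·Ω^{3/2} − Ω²/δ` at `Ω = A²e`, `e > 0` (degree `4` on the right beats degree `3`). [folklore] -/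
theorem endgame (S P e C δ ν : ℝ) (he : 0 < e) (hδ : 0 < δ) (hP : 0 ≤ P) (hν : 0 ≤ ν) :
    ∃ A : ℝ, 0 < A ∧
      C * (A ^ 2 * e * Real.sqrt (A ^ 2 * e)) - (A ^ 2 * e) ^ 2 / δ < A ^ 3 * S - ν * (A ^ 2 * P) := by
  obtain ⟨K, hK0, hKC⟩ : ∃ K : ℝ, 0 < K ∧ |C| / K ≤ 1 / (2 * δ) := by
    refine ⟨2 * δ * (|C| + 1), by positivity, ?_⟩
    rw [div_le_div_iff₀ (by positivity) (by positivity), one_mul]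
    nlinarith [abs_nonneg C]
  generalize hM : |S| + ν * P = M
  have hM0 : 0 ≤ M := by rw [← hM]; positivity
  have hKe : 0 ≤ K ^ 2 / e := by positivity
  have hMe : 0 ≤ 2 * δ * M / e ^ 2 := by positivity
  refine ⟨1 + K ^ 2 / e + 2 * δ * M / e ^ 2, by linarith, ?_⟩
  generalize hA : 1 + K ^ 2 / e + 2 * δ * M / e ^ 2 = A
  have hA1 : 1 ≤ A := by linarith
  have hA0 : 0 < A := by linarith
  have hAK : K ^ 2 / e ≤ A := by linarith
  have hAM : 2 * δ * M / e ^ 2 < A := by linarith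
  generalize hx : A ^ 2 * e = x
  have hx0 : 0 < x := by rw [← hx]; positivity
  have hxK : K ^ 2 ≤ x := by
    have h2 : K ^ 2 ≤ A * e := by rwa [div_le_iff₀ he] at hAK
    have h3 : A * e ≤ A ^ 2 * e := by nlinarith
    linarith
  have hC : C * (x * Real.sqrt x) ≤ x ^ 2 / (2 * δ) := by
    have hxs : 0 ≤ x * Real.sqrt x := by positivity
    calc C * (x * Real.sqrt x) ≤ |C| * (x * Real.sqrt x) :=
          mul_le_mul_of_nonneg_right (le_abs_self C) hxs
      _ ≤ |C| * (x ^ 2 / K) := mul_le_mul_of_nonneg_left (mul_sqrt_le_sq_div hK0 hxK) (abs_nonneg C)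
      _ = |C| / K * x ^ 2 := by ring
      _ ≤ 1 / (2 * δ) * x ^ 2 := mul_le_mul_of_nonneg_right hKC (by positivity)
      _ = x ^ 2 / (2 * δ) := by ring
  have hL : -(A ^ 3 * M) ≤ A ^ 3 * S - ν * (A ^ 2 * P) := by
    have hA3 : 0 ≤ A ^ 3 := by positivity
    have h1 : -(A ^ 3 * |S|) ≤ A ^ 3 * S := by nlinarith [neg_abs_le S]
    have hA23 : A ^ 2 ≤ A ^ 3 := by nlinarith
    have hνP : 0 ≤ ν * P := by positivity
    have h2 : ν * (A ^ 2 * P) ≤ A ^ 3 * (ν * P) := by nlinarith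
    have h3 : A ^ 3 * M = A ^ 3 * |S| + A ^ 3 * (ν * P) := by rw [← hM]; ring
    linarith
  have hmain : 2 * δ * M < A * e ^ 2 := by rwa [div_lt_iff₀ (by positivity)] at hAM
  have hx2 : x ^ 2 = A ^ 4 * e ^ 2 := by rw [← hx]; ring
  have h1 : C * (x * Real.sqrt x) - x ^ 2 / δ ≤ -(A ^ 4 * e ^ 2 / (2 * δ)) := by
    have : x ^ 2 / (2 * δ) - x ^ 2 / δ = -(A ^ 4 * e ^ 2 / (2 * δ)) := by rw [hx2]; ring
    linarith
  have h2 : A ^ 3 * M < A ^ 4 * e ^ 2 / (2 * δ) := by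
    rw [lt_div_iff₀ (by positivity)]
    have hA3 : 0 < A ^ 3 := by positivity
    have h := mul_lt_mul_of_pos_left hmain hA3
    calc A ^ 3 * M * (2 * δ) = A ^ 3 * (2 * δ * M) := by ring
      _ < A ^ 3 * (A * e ^ 2) := h
      _ = A ^ 4 * e ^ 2 := by ring
  linarith





/-! ## Adapter to the typed step -/

/-- The typed `Ω(t) = ½·(∫⁻|ω|²).toReal` is `½∫|ω|²` (Bochner) for a slice with continuous vorticity —
no finiteness needed (both sides carry the same junk value). [folklore] -/
theorem Omega_eq_half_ensq (u : ℝ → E3 → E3) (t : ℝ) (hc : Continuous (curl (u t))) :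
    Literature.Claims.NS.Guevremont2026.Omega u t = (1 / 2 : ℝ) * ensq u t := by
  unfold Literature.Claims.NS.Guevremont2026.Omega Literature.Claims.NS.Guevremont2026.ensE ensq
  have hm : AEStronglyMeasurable (fun x => ‖curl (u t) x‖ ^ 2) volume :=
    (Continuous.aestronglyMeasurable (by fun_prop))
  rw [integral_eq_lintegral_of_nonneg_ae (Eventually.of_forall fun x => by positivity) hm]
  congr 3 with x
  rw [ENNReal.ofReal_pow (norm_nonneg _), ofReal_norm]

/-- The printed right-hand side `CΩ√Ω − Ω²/δ` is continuous. [folklore] -/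
theorem continuous_law (R : Literature.Claims.NS.Guevremont2026.Resolution) :
    Continuous (Literature.Claims.NS.Guevremont2026.law R) := by
  unfold Literature.Claims.NS.Guevremont2026.law
  exact (continuous_const.mul (continuous_id.mul Real.continuous_sqrt)).sub
    ((continuous_id.pow 2).div_const _)

/-- `A • u0` is compactly supported. [folklore] -/
theorem hasCompactSupport_smul_u0 (A : ℝ) : HasCompactSupport (A • u0) :=
  hasCompactSupport_u0.comp_left (g := fun v : E3 => A • v) (smul_zero A)

/-- **C143 kill — Step 3 (§4.1 p.5 l.52–66) is false for every choice of the printed constants.**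
[cite: Guevremont2026, §4.1 p.5 l.52–66] [cite: MajdaBertozziCUP2002, Thm. 3.4 p. 104; §3.1.1 p. 87–88] -/
theorem not_Step3_EnstrophyLaw (R : Literature.Claims.NS.Guevremont2026.Resolution) :
    ¬ Literature.Claims.NS.Guevremont2026.Step3_EnstrophyLaw R := by
  intro h3
  have hδ : 0 < R.δ := R.δ_pos
  have he : 0 < (1 / 2 : ℝ) * ∫ x, ‖curl u0 x‖ ^ 2 := mul_pos (by norm_num) ens_u0_pos
  obtain ⟨A, hA, hlt⟩ := endgame (stretchI u0) (palinF u0) ((1 / 2 : ℝ) * ∫ x, ‖curl u0 x‖ ^ 2)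
    R.C R.δ 1 he hδ (palinF_nonneg u0) zero_le_one
  obtain ⟨T, hT, u, p, hsol, hΩ0, hcont, -, hder⟩ := amplitude_family one_pos A
  have hd : Literature.Claims.NS.Guevremont2026.IsDatum (1 / 2) (A • u0) :=
    Literature.Claims.NS.Guevremont2026.isDatum_of_hasCompactSupport (isDatum_smul_u0 A).1
      (isDatum_smul_u0 A).2.1 (hasCompactSupport_smul_u0 A) _
  have hS : Literature.Claims.NS.Guevremont2026.IsSolution 1 T (A • u0) u p :=
    ⟨hsol.isClassical, hsol.initial⟩
  obtain ⟨-, -, hlaw⟩ := h3 1 one_pos (1 / 2) le_rfl T (A • u0) u p hd hS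
  have hΩeq : ∀ t ∈ Ico 0 T,
      Literature.Claims.NS.Guevremont2026.Omega u t = (1 / 2 : ℝ) * ensq u t := fun t ht =>
    Omega_eq_half_ensq u t
      (continuous_curl ((hsol.isClassical.contDiff_velocity ht).of_le (by norm_cast)))
  have hsub : Icc 0 (T / 2) ⊆ Ico 0 T := fun t ht => ⟨ht.1, lt_of_le_of_lt ht.2 (by linarith)⟩
  have h0T : (0 : ℝ) ∈ Ico 0 T := ⟨le_rfl, hT⟩
  have hderΩ : HasDerivWithinAt (Literature.Claims.NS.Guevremont2026.Omega u)
      (A ^ 3 * stretchI u0 - 1 * (A ^ 2 * palinF u0)) (Icc 0 (T / 2)) 0 :=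
    hder.congr (fun t ht => hΩeq t (hsub ht)) (hΩeq 0 h0T)
  have hcontΩ : ContinuousOn (Literature.Claims.NS.Guevremont2026.Omega u) (Icc 0 (T / 2)) :=
    hcont.congr fun t ht => hΩeq t (hsub ht)
  have hτ : 0 < T / 2 := by linarith
  have hd' : ∀ t ∈ Ioo 0 (T / 2),
      DifferentiableAt ℝ (Literature.Claims.NS.Guevremont2026.Omega u) t := fun t ht =>
    (hlaw t ⟨ht.1, by linarith [ht.2]⟩).1
  have hle : ∀ t ∈ Ioo 0 (T / 2), deriv (Literature.Claims.NS.Guevremont2026.Omega u) t ≤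
      Literature.Claims.NS.Guevremont2026.law R (Literature.Claims.NS.Guevremont2026.Omega u t) :=
    fun t ht => (hlaw t ⟨ht.1, by linarith [ht.2]⟩).2
  have key := rightDeriv_le_of_deriv_le hτ hderΩ hcontΩ hd' hle (continuous_law R).continuousAt
  rw [hΩeq 0 h0T, hΩ0] at key
  unfold Literature.Claims.NS.Guevremont2026.law at key
  linarith

end Summit.NavierStokesRegularity.NavierStokesRegularity.Theorems.Guevremont2026

end
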